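import Summits.Ventures.Crystal3D.Theorems.StickyWulffConstantGenericWallFloorAtOfLedger
import Summits.Ventures.Crystal3D.Theorems.StickyWulffConstantGenericWallFloorAtHalf
import Summits.Ventures.Crystal3D.Theorems.StickyWulffConstantGenericWallFloorSampleDeficitUpper
import HarnessLib

/-!
# Re-framing a grain by a LATTICE SYMMETRY does not change the wall-floor statements (crux `GenericWallFloor`, stmt-Ventures-19480,
# line `WallLedgerG`; L-2′ input: the MIRROR terrace family is certified by the same capstones)

HONEST FRAMING. Venture `Summits/Ventures/Crystal3D` (cell `crystal3d-full`), helper `--supports` the crux `GenericWallFloor` of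
`route-Ventures-StickyWulffConstant`, REGISTERED line `WallLedgerG`, open stub `stub_twoSlabAdhesion`.  Pure bookkeeping; rung credit
only; F-C1 not moved.

The per-pair statements `GenericWallFloorAtCharge c A₁ t₁ A₂ t₂` (and `GenericWallFloorAt`, `TwoSlabLedgerAt`) see the frame `A₁` only
through the affine lattice `A₁·Λ₀ + t₁` and the face weight `φ(A₁⁻¹e₃) = (√2/4)·Σ_{w unit in Λ₀} |⟪w, A₁⁻¹e₃⟫|`.  Both are unchanged when
`A₁` is replaced by `A₁ ∘ S` for a linear isometry `S` with `S·Λ₀ = Λ₀` (a point symmetry of the lattice: `S` permutes the twelve slots).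
* `image_fccSlots_latticeSymm` — `S` permutes `fccSlots`;
* `image_affine_trans_latticeSymm`, `finsum_unit_fcc_trans_latticeSymm` — the two invariants;
* **`genericWallFloorAtCharge_trans_latticeSymm_iff₁/₂`**, `twoSlabLedgerAt_trans_latticeSymm_iff₁` — the statements for `(S.trans A₁, t₁)`
  and `(A₁, t₁)` are EQUIVALENT (likewise in the second grain).
USE (L-2′): every one-sided capstone stated for a launch slot `u` in frame `A` (e.g. the terrace family `u = slotSite 8 = (0,1,1)/√2`,
`…RayTerraceCapstone[Half]`) yields the same charge for the MIRROR family `S u` of the same grain by applying it to the frame `A ∘ S⁻¹`…`S`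
(the cubic `x ↔ y` swap fixes `w₀ = (1,1,4)/3√2` and the terrace letters), and transporting back with the `iff`.
WHAT THIS IS NOT: no new ledger; the concrete swap isometry is not constructed here; F-C1 not moved.
-/

noncomputable section

namespace Summit.Ventures.Crystal3D.Theorems

open Summit.Ventures.Crystal3D Finset
open Literature.MathematicalPhysics.StatisticalMechanics (fccStacking isHaggSeq_const le_dist_of_mem_barlowStacking_ideal)
open scoped InnerProductSpace

/-- A lattice symmetry maps slots to slots. -/
theorem latticeSymm_mem_fccSlots (S : EuclideanSpace ℝ (Fin 3) ≃ₗᵢ[ℝ] EuclideanSpace ℝ (Fin 3))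
    (hS : S '' fccStacking 1 (Real.sqrt (2 / 3)) = fccStacking 1 (Real.sqrt (2 / 3))) {w : EuclideanSpace ℝ (Fin 3)}
    (hw : w ∈ fccSlots) : S w ∈ fccSlots := by
  have hmem : S w ∈ fccStacking 1 (Real.sqrt (2 / 3)) := by rw [← hS]; exact ⟨w, mem_fcc_of_mem_fccSlots hw, rfl⟩
  have hunit : S w ∈ {w ∈ fccStacking 1 (Real.sqrt (2 / 3)) | ‖w‖ = 1} :=
    ⟨hmem, by rw [LinearIsometryEquiv.norm_map, norm_eq_one_of_mem_fccSlots hw]⟩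
  rw [setOf_unit_fcc_eq_fccSlots] at hunit
  exact_mod_cast hunit

/-- **A lattice symmetry permutes the twelve slots.** -/
theorem image_fccSlots_latticeSymm (S : EuclideanSpace ℝ (Fin 3) ≃ₗᵢ[ℝ] EuclideanSpace ℝ (Fin 3))
    (hS : S '' fccStacking 1 (Real.sqrt (2 / 3)) = fccStacking 1 (Real.sqrt (2 / 3))) :
    fccSlots.image S = fccSlots := by
  classical
  refine Finset.eq_of_subset_of_card_le (fun x hx => ?_) ?_
  · obtain ⟨w, hw, rfl⟩ := Finset.mem_image.1 hx
    exact latticeSymm_mem_fccSlots S hS hw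
  · rw [Finset.card_image_of_injective _ S.injective]

/-- The affine lattice of a re-framed grain is the same set. -/
theorem image_affine_trans_latticeSymm (S A : EuclideanSpace ℝ (Fin 3) ≃ₗᵢ[ℝ] EuclideanSpace ℝ (Fin 3))
    (hS : S '' fccStacking 1 (Real.sqrt (2 / 3)) = fccStacking 1 (Real.sqrt (2 / 3))) (t : EuclideanSpace ℝ (Fin 3)) :
    (fun p => (S.trans A) p + t) '' fccStacking 1 (Real.sqrt (2 / 3)) = (fun p => A p + t) '' fccStacking 1 (Real.sqrt (2 / 3)) := by
  have h1 : (fun p => (S.trans A) p + t) = (fun p => A p + t) ∘ S := by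
    funext p; simp [LinearIsometryEquiv.trans_apply]
  rw [h1, Set.image_comp, hS]

/-- The face weight of a re-framed grain is the same number. -/
theorem finsum_unit_fcc_trans_latticeSymm (S A : EuclideanSpace ℝ (Fin 3) ≃ₗᵢ[ℝ] EuclideanSpace ℝ (Fin 3))
    (hS : S '' fccStacking 1 (Real.sqrt (2 / 3)) = fccStacking 1 (Real.sqrt (2 / 3))) (x : EuclideanSpace ℝ (Fin 3)) :
    ∑ᶠ w ∈ {w ∈ fccStacking 1 (Real.sqrt (2 / 3)) | ‖w‖ = 1}, |⟪w, (S.trans A).symm x⟫_ℝ| =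
      ∑ᶠ w ∈ {w ∈ fccStacking 1 (Real.sqrt (2 / 3)) | ‖w‖ = 1}, |⟪w, A.symm x⟫_ℝ| := by
  classical
  rw [finsum_unit_fcc_eq_sum, finsum_unit_fcc_eq_sum]
  have hsymm : ∀ w, ⟪w, (S.trans A).symm x⟫_ℝ = ⟪S w, A.symm x⟫_ℝ := fun w => by
    rw [LinearIsometryEquiv.symm_trans, LinearIsometryEquiv.trans_apply, ← LinearIsometryEquiv.inner_map_map S w (S.symm (A.symm x)),
      LinearIsometryEquiv.apply_symm_apply]
  simp_rw [hsymm]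
  have himg := image_fccSlots_latticeSymm S hS
  conv_rhs => rw [← himg]
  rw [Finset.sum_image fun a _ b _ hab => S.injective hab]

/-- **Re-framing grain 1 by a lattice symmetry: `GenericWallFloorAtCharge` is equivalent.** -/
theorem genericWallFloorAtCharge_trans_latticeSymm_iff₁ (S : EuclideanSpace ℝ (Fin 3) ≃ₗᵢ[ℝ] EuclideanSpace ℝ (Fin 3))
    (hS : S '' fccStacking 1 (Real.sqrt (2 / 3)) = fccStacking 1 (Real.sqrt (2 / 3))) (c : ℝ)
    (A₁ : EuclideanSpace ℝ (Fin 3) ≃ₗᵢ[ℝ] EuclideanSpace ℝ (Fin 3)) (t₁ : EuclideanSpace ℝ (Fin 3))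
    (A₂ : EuclideanSpace ℝ (Fin 3) ≃ₗᵢ[ℝ] EuclideanSpace ℝ (Fin 3)) (t₂ : EuclideanSpace ℝ (Fin 3)) :
    GenericWallFloorAtCharge c (S.trans A₁) t₁ A₂ t₂ ↔ GenericWallFloorAtCharge c A₁ t₁ A₂ t₂ := by
  unfold GenericWallFloorAtCharge
  rw [image_affine_trans_latticeSymm S A₁ hS t₁, finsum_unit_fcc_trans_latticeSymm S A₁ hS]

/-- **Re-framing grain 2 by a lattice symmetry: `GenericWallFloorAtCharge` is equivalent.** -/
theorem genericWallFloorAtCharge_trans_latticeSymm_iff₂ (S : EuclideanSpace ℝ (Fin 3) ≃ₗᵢ[ℝ] EuclideanSpace ℝ (Fin 3))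
    (hS : S '' fccStacking 1 (Real.sqrt (2 / 3)) = fccStacking 1 (Real.sqrt (2 / 3))) (c : ℝ)
    (A₁ : EuclideanSpace ℝ (Fin 3) ≃ₗᵢ[ℝ] EuclideanSpace ℝ (Fin 3)) (t₁ : EuclideanSpace ℝ (Fin 3))
    (A₂ : EuclideanSpace ℝ (Fin 3) ≃ₗᵢ[ℝ] EuclideanSpace ℝ (Fin 3)) (t₂ : EuclideanSpace ℝ (Fin 3)) :
    GenericWallFloorAtCharge c A₁ t₁ (S.trans A₂) t₂ ↔ GenericWallFloorAtCharge c A₁ t₁ A₂ t₂ := by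
  unfold GenericWallFloorAtCharge
  rw [image_affine_trans_latticeSymm S A₂ hS t₂, finsum_unit_fcc_trans_latticeSymm S A₂ hS]

/-- **Re-framing grain 1 by a lattice symmetry: `TwoSlabLedgerAt` is equivalent.** -/
theorem twoSlabLedgerAt_trans_latticeSymm_iff₁ (S : EuclideanSpace ℝ (Fin 3) ≃ₗᵢ[ℝ] EuclideanSpace ℝ (Fin 3))
    (hS : S '' fccStacking 1 (Real.sqrt (2 / 3)) = fccStacking 1 (Real.sqrt (2 / 3))) (q : ℝ)
    (A₁ : EuclideanSpace ℝ (Fin 3) ≃ₗᵢ[ℝ] EuclideanSpace ℝ (Fin 3)) (t₁ : EuclideanSpace ℝ (Fin 3))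
    (A₂ : EuclideanSpace ℝ (Fin 3) ≃ₗᵢ[ℝ] EuclideanSpace ℝ (Fin 3)) (t₂ : EuclideanSpace ℝ (Fin 3)) :
    TwoSlabLedgerAt q (S.trans A₁) t₁ A₂ t₂ ↔ TwoSlabLedgerAt q A₁ t₁ A₂ t₂ := by
  unfold TwoSlabLedgerAt
  rw [image_affine_trans_latticeSymm S A₁ hS t₁, finsum_unit_fcc_trans_latticeSymm S A₁ hS]

/-- **The genuine crux matrix, re-framed**: `GenericWallFloorAt (S.trans A₁) t₁ A₂ t₂ ↔ GenericWallFloorAt A₁ t₁ A₂ t₂`. -/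
theorem genericWallFloorAt_trans_latticeSymm_iff₁ (S : EuclideanSpace ℝ (Fin 3) ≃ₗᵢ[ℝ] EuclideanSpace ℝ (Fin 3))
    (hS : S '' fccStacking 1 (Real.sqrt (2 / 3)) = fccStacking 1 (Real.sqrt (2 / 3)))
    (A₁ : EuclideanSpace ℝ (Fin 3) ≃ₗᵢ[ℝ] EuclideanSpace ℝ (Fin 3)) (t₁ : EuclideanSpace ℝ (Fin 3))
    (A₂ : EuclideanSpace ℝ (Fin 3) ≃ₗᵢ[ℝ] EuclideanSpace ℝ (Fin 3)) (t₂ : EuclideanSpace ℝ (Fin 3)) :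
    GenericWallFloorAt (S.trans A₁) t₁ A₂ t₂ ↔ GenericWallFloorAt A₁ t₁ A₂ t₂ := by
  unfold GenericWallFloorAt
  rw [image_affine_trans_latticeSymm S A₁ hS t₁, finsum_unit_fcc_trans_latticeSymm S A₁ hS]

end Summit.Ventures.Crystal3D.Theorems

end
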